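import Summits.HubbardSuperconductivity.HubbardSuperconductivity.Theorems.NodalDiracTwistNodalDiracWeakCouplingOfLocusParity

/-!
# The crux `NodalDiracWeakCoupling` is EQUIVALENT to LOCUS + the parity flip (line `birth` v9)

Route `HubbardSuperconductivity/NodalDiracTwist`, crux stmt-HubbardSuperconductivity-10370
(`NodalDiracWeakCoupling`). The glue `nodalDiracWeakCoupling_of_locusParity`
(`…OfLocusParity.lean`) derives the crux from the physics statement `stub_locusParity` of the
skeleton `Cruxes/NodalDiracWeakCoupling/Lines/birth.lean` v9:

* LOCUS on the closed triangle `0 ≤ φ₁ ≤ φ₀ ≤ π`: the `(N_L, S^z = 0)`-sector ground state of the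
  spin-twisted torus `H_L(U, φ)` admits an orthogonal pair iff `φ = (c, c)`;
* NC1: sector ground states of `H_L(U, (0,0))` (the periodic Hubbard torus) and of `H_L(U, (π,π))`
  (spin-gauge equivalent to the doubly antiperiodic Hubbard torus) are eigenvectors of the
  `x₀ ↔ x₁` swap `U_{sr 3}` with OPPOSITE signs.

Here the converse, `locusParity_of_nodalDiracWeakCoupling`: LOCUS on the triangle is the
restriction of the crux's LOCUS clause, and NC1 is the landed `swapSign_pi_opposite_swapSign_zero`
(Bridge c12: constancy of the swap sign on the diagonal segments of uniqueness and the flip across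
the holonomy `−1` point `(c, c)`), applied for `L ≥ 3` (`spinTwistedHubbardTorus_zero`) with one
admissible radius `r = min(c, π − c)/2`. Hence `nodalDiracWeakCoupling_iff_locusParity`: the crux
carries exactly one bit beyond its LOCUS clause — the relative swap parity of the periodic and the
antiperiodic ground states; no cone, two-foldness or holonomy statement remains in the open
physics.

## References

H. C. Longuet-Higgins, Proc. R. Soc. A 344 (1975) 147; Y. Hatsugai, J. Phys. Soc. Jpn. 75 (2006)
123601; D. J. Scalapino, Phys. Rep. 250 (1995) 329, §2. No new definitions, no named facts.
-/

-- the mandated namespace repeats `HubbardSuperconductivity` (single-problem summit, D-0017)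
set_option linter.dupNamespace false

noncomputable section

namespace Summit.HubbardSuperconductivity.HubbardSuperconductivity.Theorems.NodalDiracTwist

open Literature.MathematicalPhysics.QuantumLattice Literature.Probability.LatticeModels Matrix
open Summit.HubbardSuperconductivity.HubbardSuperconductivity.Theses.NodalDiracTwist
open Summit.HubbardSuperconductivity.HubbardSuperconductivity.Theorems.NodalDiracTwist.BridgeNodalToDWave
open scoped BigOperators ComplexOrder Matrix

/-- **NC1 from the nodal-Dirac package at one `L ≥ 3`.** If the LOCUS clause holds on the cell
with `0 < c < π` and the SIGN clause holds at `(c, c)` for the radius `min(c, π − c)/2`, then there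
are sector ground states at the twists `(0,0)` and `(π,π)` with opposite swap signs
(`swapSign_pi_opposite_swapSign_zero` + existence of sector ground states, the sector being
non-trivial because it is degenerate at `(c,c)`). Hatsugai (2006); Longuet-Higgins (1975).
[folklore] -/
theorem nc1_of_package (L : ℕ) [NeZero L] (hL : 3 ≤ L) (U : ℝ) (N : ℕ) {c : ℝ} (hc0 : 0 < c)
    (hcπ : c < Real.pi)
    (hlocus : ∀ φ : Fin 2 → ℝ, φ 0 ∈ Set.Ioc (-Real.pi) Real.pi →
      φ 1 ∈ Set.Ioc (-Real.pi) Real.pi →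
        ((∃ ψ₁ ψ₂ : Fock (Orb (FermionTorus 2 L)),
            IsGroundStateInSector (spinTwistedHubbardTorus L U φ) N 0 ψ₁ ∧
            IsGroundStateInSector (spinTwistedHubbardTorus L U φ) N 0 ψ₂ ∧
            star ψ₁ ⬝ᵥ ψ₂ = 0) ↔ (|φ 0| = c ∧ |φ 1| = c)))
    (hsign : ∀ r : ℝ, 0 < r → r < min c (Real.pi - c) →
      ∃ n₀ : ℕ, ∀ n ≥ n₀, ∀ ψ : Fin n → Fock (Orb (FermionTorus 2 L)),
        (∀ i : Fin n,
          IsGroundStateInSector (spinTwistedHubbardTorus L U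
              (fun ν : Fin 2 => (fun _ : Fin 2 => c) ν + r *
                    (if ν = 0 then Real.cos (2 * Real.pi * (i : ℕ) / n)
                      else Real.sin (2 * Real.pi * (i : ℕ) / n)))) N 0 (ψ i) ∧
            star (ψ i) ⬝ᵥ ψ i = 1) →
        (∏ i : Fin n, star (ψ i) ⬝ᵥ ψ (finRotate n i)).re < 0) :
    ∃ χ₀ χπ : Fock (Orb (FermionTorus 2 L)),
      IsGroundStateInSector (spinTwistedHubbardTorus L U (fun _ : Fin 2 => (0 : ℝ))) N 0 χ₀ ∧
      IsGroundStateInSector (spinTwistedHubbardTorus L U (fun _ : Fin 2 => Real.pi)) N 0 χπ ∧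
      (((@fockD4 L _ (DihedralGroup.sr 3)).val *ᵥ χ₀ = χ₀ ∧
          (@fockD4 L _ (DihedralGroup.sr 3)).val *ᵥ χπ = -χπ) ∨
        ((@fockD4 L _ (DihedralGroup.sr 3)).val *ᵥ χ₀ = -χ₀ ∧
          (@fockD4 L _ (DihedralGroup.sr 3)).val *ᵥ χπ = χπ)) := by
  classical
  -- the sector is non-trivial: it is degenerate at `(c, c)`
  obtain ⟨ψ₁, -, hψ₁, -, -⟩ := (hlocus (fun _ : Fin 2 => c) ⟨by linarith [Real.pi_pos], hcπ.le⟩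
    ⟨by linarith [Real.pi_pos], hcπ.le⟩).2 ⟨abs_of_pos hc0, abs_of_pos hc0⟩
  have hK : (szSector N 0 : Submodule ℂ (Fock (Orb (FermionTorus 2 L)))) ≠ ⊥ :=
    (Submodule.ne_bot_iff _).2 ⟨ψ₁, hψ₁.1, hψ₁.2.1⟩
  have hex : ∀ φ : Fin 2 → ℝ, ∃ v : Fock (Orb (FermionTorus 2 L)),
      IsGroundStateInSector (spinTwistedHubbardTorus L U φ) N 0 v := fun φ => by
    obtain ⟨v, hv, h1, he⟩ := exists_unit_eigen_minEnergyOn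
      (spinTwistedHubbardTorus_isHermitian L U φ) (szSector N 0)
      (fun v hv => spinTwistedHubbardTorus_mulVec_mem_szSector L U φ hv) hK
    exact ⟨v, hv, ne_zero_of_unit h1, he⟩
  obtain ⟨χ₀, hχ₀⟩ := hex (fun _ : Fin 2 => (0 : ℝ))
  obtain ⟨χπ, hχπ⟩ := hex (fun _ : Fin 2 => Real.pi)
  -- at zero twist the spin-twisted torus is the Hubbard torus (`L ≥ 3`)
  have h0 : spinTwistedHubbardTorus L U (fun _ : Fin 2 => (0 : ℝ)) = hubbardTorus 2 L 1 U :=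
    spinTwistedHubbardTorus_zero L hL U
  have hχ₀' : IsGroundStateInSector (hubbardTorus 2 L 1 U) N 0 χ₀ := h0 ▸ hχ₀
  -- one admissible radius
  have hm : 0 < min c (Real.pi - c) := lt_min hc0 (by linarith)
  set r : ℝ := min c (Real.pi - c) / 2 with hr
  have hr0 : 0 < r := by rw [hr]; linarith
  have hrc : r < min c (Real.pi - c) := by rw [hr]; linarith
  refine ⟨χ₀, χπ, hχ₀, hχπ, ?_⟩
  exact swapSign_pi_opposite_swapSign_zero L hL U N hlocus (fun _ : Fin 2 => c) rfl rfl hr0 hrc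
    (hsign r hr0 hrc) hχ₀' hχπ

/-- **The crux implies LOCUS + the parity flip** (converse of `nodalDiracWeakCoupling_of_locusParity`):
LOCUS on the triangle is the restriction of the crux's LOCUS clause to `0 ≤ φ₁ ≤ φ₀ ≤ π`, and NC1 is
`nc1_of_package` (for `L ≥ max(L₀, 3)`). Hatsugai (2006); Longuet-Higgins (1975). [folklore] -/
theorem locusParity_of_nodalDiracWeakCoupling (hND : NodalDiracWeakCoupling) :
    ∀ U₀ : ℝ, 0 < U₀ → ∃ U ∈ Set.Ioo (0 : ℝ) U₀, ∃ δ ∈ Set.Icc (1 / 10 : ℝ) (3 / 10),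
      ∃ κ : ℝ, 0 < κ ∧ κ < Real.pi ∧ Real.cos κ ≠ 0 ∧ ∀ ε : ℝ, 0 < ε → ∃ L₀ : ℕ,
        ∀ (L : ℕ) [NeZero L], Even L → L₀ ≤ L → (∀ m : ℤ, ε ≤ |L * κ - m * Real.pi|) →
          ∃ c : ℝ, 0 < c ∧ c < Real.pi ∧ |Real.cos c - Real.cos (L * κ)| ≤ ε ∧
            (∀ φ : Fin 2 → ℝ, 0 ≤ φ 1 → φ 1 ≤ φ 0 → φ 0 ≤ Real.pi →
                ((∃ ψ₁ ψ₂ : Fock (Orb (FermionTorus 2 L)),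
                    IsGroundStateInSector (spinTwistedHubbardTorus L U φ) (2 * ⌊(1 - δ) * (L : ℝ) ^ 2 / 2⌋₊) 0 ψ₁ ∧
                    IsGroundStateInSector (spinTwistedHubbardTorus L U φ) (2 * ⌊(1 - δ) * (L : ℝ) ^ 2 / 2⌋₊) 0 ψ₂ ∧
                    star ψ₁ ⬝ᵥ ψ₂ = 0) ↔ (φ 0 = c ∧ φ 1 = c))) ∧
            (∃ χ₀ χπ : Fock (Orb (FermionTorus 2 L)),
                IsGroundStateInSector (spinTwistedHubbardTorus L U (fun _ : Fin 2 => (0 : ℝ))) (2 * ⌊(1 - δ) * (L : ℝ) ^ 2 / 2⌋₊) 0 χ₀ ∧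
                IsGroundStateInSector (spinTwistedHubbardTorus L U (fun _ : Fin 2 => Real.pi)) (2 * ⌊(1 - δ) * (L : ℝ) ^ 2 / 2⌋₊) 0 χπ ∧
                (((@fockD4 L _ (DihedralGroup.sr 3)).val *ᵥ χ₀ = χ₀ ∧
                    (@fockD4 L _ (DihedralGroup.sr 3)).val *ᵥ χπ = -χπ) ∨
                  ((@fockD4 L _ (DihedralGroup.sr 3)).val *ᵥ χ₀ = -χ₀ ∧
                    (@fockD4 L _ (DihedralGroup.sr 3)).val *ᵥ χπ = χπ))) := by
  intro U₀ hU₀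
  obtain ⟨U, hU, δ, hδ, κ, hκ0, hκπ, hcos, hε⟩ := hND U₀ hU₀
  refine ⟨U, hU, δ, hδ, κ, hκ0, hκπ, hcos, fun ε hε0 => ?_⟩
  obtain ⟨L₀, hL⟩ := hε ε hε0
  refine ⟨max L₀ 3, fun L _ hEven hL₀ hres => ?_⟩
  have hL3 : 3 ≤ L := le_trans (le_max_right _ _) hL₀
  obtain ⟨c, hc0, hcπ, hcc, hlocus, hsign⟩ := hL L hEven (le_trans (le_max_left _ _) hL₀) hres
  set N : ℕ := 2 * ⌊(1 - δ) * (L : ℝ) ^ 2 / 2⌋₊ with hN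
  -- the route's inlined `let H` is `spinTwistedHubbardTorus L U` by `rfl`
  have hlocus' : ∀ φ : Fin 2 → ℝ, φ 0 ∈ Set.Ioc (-Real.pi) Real.pi →
      φ 1 ∈ Set.Ioc (-Real.pi) Real.pi →
        ((∃ ψ₁ ψ₂ : Fock (Orb (FermionTorus 2 L)),
            IsGroundStateInSector (spinTwistedHubbardTorus L U φ) N 0 ψ₁ ∧
            IsGroundStateInSector (spinTwistedHubbardTorus L U φ) N 0 ψ₂ ∧
            star ψ₁ ⬝ᵥ ψ₂ = 0) ↔ (|φ 0| = c ∧ |φ 1| = c)) := hlocus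
  refine ⟨c, hc0, hcπ, hcc, fun φ h1 h10 h0π => ?_, ?_⟩
  · have hπ := Real.pi_pos
    have key := hlocus' φ ⟨by linarith, h0π⟩ ⟨by linarith, by linarith⟩
    rw [abs_of_nonneg (le_trans h1 h10), abs_of_nonneg h1] at key
    exact key
  · exact nc1_of_package L hL3 U N hc0 hcπ hlocus'
      (fun r hr0 hrc => hsign (fun _ : Fin 2 => c) (abs_of_pos hc0) (abs_of_pos hc0) r hr0 hrc)

/-- **`NodalDiracWeakCoupling` ⟺ LOCUS on the triangle + NC1** (route NodalDiracTwist, crux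
stmt-HubbardSuperconductivity-10370; line `birth` v9): the nodal-Dirac package at arbitrarily weak
repulsion — exact degeneracy locus of the `(N_L, S^z = 0)`-sector ground state over the cell of
opposite spin twists = the diagonal quartet `(±c, ±c)`, `|cos c − cos Lκ| ≤ ε`, with `ℤ₂` holonomy
`−1` around each point — holds iff the locus clause holds on the fundamental triangle AND the sector
ground states of the periodic (`(0,0)`) and the doubly antiperiodic (`(π,π)`, spin gauge) Hubbard
tori have opposite `x₀ ↔ x₁` parity. (`nodalDiracWeakCoupling_of_locusParity`,
`locusParity_of_nodalDiracWeakCoupling`.) Longuet-Higgins (1975); Hatsugai (2006). [folklore] -/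
theorem nodalDiracWeakCoupling_iff_locusParity :
    NodalDiracWeakCoupling ↔
    (∀ U₀ : ℝ, 0 < U₀ → ∃ U ∈ Set.Ioo (0 : ℝ) U₀, ∃ δ ∈ Set.Icc (1 / 10 : ℝ) (3 / 10),
      ∃ κ : ℝ, 0 < κ ∧ κ < Real.pi ∧ Real.cos κ ≠ 0 ∧ ∀ ε : ℝ, 0 < ε → ∃ L₀ : ℕ,
        ∀ (L : ℕ) [NeZero L], Even L → L₀ ≤ L → (∀ m : ℤ, ε ≤ |L * κ - m * Real.pi|) →
          ∃ c : ℝ, 0 < c ∧ c < Real.pi ∧ |Real.cos c - Real.cos (L * κ)| ≤ ε ∧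
            (∀ φ : Fin 2 → ℝ, 0 ≤ φ 1 → φ 1 ≤ φ 0 → φ 0 ≤ Real.pi →
                ((∃ ψ₁ ψ₂ : Fock (Orb (FermionTorus 2 L)),
                    IsGroundStateInSector (spinTwistedHubbardTorus L U φ) (2 * ⌊(1 - δ) * (L : ℝ) ^ 2 / 2⌋₊) 0 ψ₁ ∧
                    IsGroundStateInSector (spinTwistedHubbardTorus L U φ) (2 * ⌊(1 - δ) * (L : ℝ) ^ 2 / 2⌋₊) 0 ψ₂ ∧
                    star ψ₁ ⬝ᵥ ψ₂ = 0) ↔ (φ 0 = c ∧ φ 1 = c))) ∧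
            (∃ χ₀ χπ : Fock (Orb (FermionTorus 2 L)),
                IsGroundStateInSector (spinTwistedHubbardTorus L U (fun _ : Fin 2 => (0 : ℝ))) (2 * ⌊(1 - δ) * (L : ℝ) ^ 2 / 2⌋₊) 0 χ₀ ∧
                IsGroundStateInSector (spinTwistedHubbardTorus L U (fun _ : Fin 2 => Real.pi)) (2 * ⌊(1 - δ) * (L : ℝ) ^ 2 / 2⌋₊) 0 χπ ∧
                (((@fockD4 L _ (DihedralGroup.sr 3)).val *ᵥ χ₀ = χ₀ ∧
                    (@fockD4 L _ (DihedralGroup.sr 3)).val *ᵥ χπ = -χπ) ∨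
                  ((@fockD4 L _ (DihedralGroup.sr 3)).val *ᵥ χ₀ = -χ₀ ∧
                    (@fockD4 L _ (DihedralGroup.sr 3)).val *ᵥ χπ = χπ)))) :=
  ⟨locusParity_of_nodalDiracWeakCoupling, nodalDiracWeakCoupling_of_locusParity⟩

end Summit.HubbardSuperconductivity.HubbardSuperconductivity.Theorems.NodalDiracTwist

end
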